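import Summits.AtomisticToContinuum.BoseEinsteinCondensation.Theorems.BECThomsonPrincipleGDTransferLnssAlgebra
import Summits.AtomisticToContinuum.BoseEinsteinCondensation.Theorems.BECThomsonPrincipleGDTransferChordVariationForms

/-!
# Route `BECThomsonPrinciple`, crux `GDTransfer` (stmt-AtomisticToContinuum-9482), line `dyson-dressed-witness`:
# stub `bareAdmissible`, part 1 — integrating out one slot: Jensen for `P_i`, mass and interaction bounds

Support file of `stub_bareAdmissible` (`LNSSAlgebra → BareAdmissibility`: a-priori mass/energy bounds of
the bare LNSS pair `Λ_n†Ψ`, `Λ_nΨ` for integrable `v`).  The crux's cell average in slot `i`,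
`P_i h (X) = L⁻³ ∫_cell h(X; x_i ↦ y) dy` (`Negative.cellAvg`), is controlled slot by slot:
* (Fubini in slot `i`) against a weight `F ≥ 0` that does not depend on `x_i`, the `ℝ≥0∞`-average
  `L⁻³ ∫⁻_cell G(X; x_i ↦ y) dy` integrates over `cell^N` like `G` itself (`lintegral_cellN_mul_slotAvg`);
* (Jensen / Cauchy–Schwarz on the cell) `|P_i h(X)|² ≤ L⁻³ ∫_cell |h(X; x_i ↦ y)|² dy` (`nnnorm_sq_cellAvg_le`);
* hence `‖P_i h‖² ≤ ‖h‖²` on `cell^N` (`mass_cellAvg_le`), and for the periodised pair potentials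
  `W_{ab} = v^per(x_a - x_b)`: `∫ W_{ab}|P_i h|² ≤ ∫ W_{ab}|h|²` if `i ∉ {a, b}` (Jensen + Fubini), while for
  `i ∈ {a, b}` the slot integral unfolds the periodisation, `∫_cell v^per(y - z) dy = ‖v‖₁ := ∫_{ℝ³} v(|x|)dx`
  (`lintegral_cell_periodizedPotential_sub`), giving `∫ W_{ab}|P_i h|² ≤ L⁻³‖v‖₁‖h‖²`; summed over pairs,
  `∫ V|P_i h|² ≤ ∫ V|h|² + N² L⁻³ ‖v‖₁ ‖h‖²` (`lintegral_interaction_sq_cellAvg_le`), `V = Σ_{a<b} W_{ab}`.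
All [folklore] (LSSY2005 App. A; arXiv:1211.2778 §2).
-/

noncomputable section

open MeasureTheory Filter
open scoped ENNReal NNReal ComplexConjugate

namespace Summit.AtomisticToContinuum.BoseEinsteinCondensation.Cruxes.GDTransfer.DysonDressedWitness

namespace Bare

open Literature.MathematicalPhysics.QuantumManyBody.BoseGas
open Summit.AtomisticToContinuum.BoseEinsteinCondensation.Theorems.GaussianDominationCan.Negative

variable {N n : ℕ} {L : ℝ}

/-! ## Integrating out one slot -/

/-- The `ℝ≥0∞` slot integral `X ↦ ∫⁻_cell G(X; x_i ↦ y) dy` is measurable. [folklore] -/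
theorem measurable_lintegral_update (i : Fin N) {G : Config N → ℝ≥0∞} (hG : Measurable G) :
    Measurable fun X : Config N => ∫⁻ y in cell L, G (Function.update X i y) := by
  have h : Measurable fun p : Config N × Space => G (Function.update p.1 i p.2) :=
    hG.comp measurable_update'
  exact h.lintegral_prod_right'

/-- **Fubini in slot `i`**: against a weight `F` not depending on `x_i`,
`∫_{cell^{n+1}} F·G = ∫_{cell^n} F · (∫_cell G dx_i)`. [folklore] -/
theorem lintegral_cellN_slot (L : ℝ) (i : Fin (n + 1)) {F G : Config (n + 1) → ℝ≥0∞}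
    (hF : Measurable F) (hG : Measurable G)
    (hFi : ∀ (X : Config (n + 1)) (y : Space), F (Function.update X i y) = F X) :
    ∫⁻ X in cellN (n + 1) L, F X * G X =
      ∫⁻ Y in cellN n L, F (i.insertNth 0 Y) * ∫⁻ x in cell L, G (i.insertNth x Y) := by
  set e := MeasurableEquiv.piFinSuccAbove (fun _ : Fin (n + 1) => Space) i with he
  have hmp := measurePreserving_piFinSuccAbove_cellN (n := n) i L
  have hes : ∀ p : Space × Config n, e.symm p = i.insertNth p.1 p.2 := fun _ => rfl
  rw [← (hmp.symm e).lintegral_comp_emb e.symm.measurableEmbedding]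
  have hmeas : AEMeasurable (fun p : Space × Config n => F (e.symm p) * G (e.symm p))
      (((volume : Measure Space).restrict (cell L)).prod
        ((volume : Measure (Config n)).restrict (cellN n L))) :=
    ((hF.comp e.symm.measurable).mul (hG.comp e.symm.measurable)).aemeasurable
  rw [lintegral_prod_symm _ hmeas]
  refine lintegral_congr fun Y => ?_
  simp only [hes]
  have hFx : ∀ x : Space, F (i.insertNth x Y) = F (i.insertNth 0 Y) := fun x => by
    have h := hFi (i.insertNth 0 Y) x
    rwa [Fin.update_insertNth] at h
  simp only [hFx]
  have hGx : Measurable fun x : Space => G (i.insertNth x Y) := by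
    have h1 : Measurable fun x : Space => e.symm (x, Y) :=
      e.symm.measurable.comp measurable_prodMk_right
    exact hG.comp h1
  rw [lintegral_const_mul _ hGx]

/-- **The slot average integrates like the function**: for `F ≥ 0` not depending on `x_i` and `L > 0`,
`∫_{cell^N} F(X) · (L⁻³ ∫⁻_cell G(X; x_i ↦ y) dy) dX = ∫_{cell^N} F G`. [folklore] -/
theorem lintegral_cellN_mul_slotAvg (hL : 0 < L) (i : Fin (n + 1)) {F G : Config (n + 1) → ℝ≥0∞}
    (hF : Measurable F) (hG : Measurable G)
    (hFi : ∀ (X : Config (n + 1)) (y : Space), F (Function.update X i y) = F X) :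
    ∫⁻ X in cellN (n + 1) L, F X *
        ((ENNReal.ofReal (L ^ 3))⁻¹ * ∫⁻ y in cell L, G (Function.update X i y)) =
      ∫⁻ X in cellN (n + 1) L, F X * G X := by
  have hL3 : ENNReal.ofReal (L ^ 3) ≠ 0 := (ENNReal.ofReal_pos.2 (by positivity)).ne'
  have hA : Measurable fun X : Config (n + 1) =>
      (ENNReal.ofReal (L ^ 3))⁻¹ * ∫⁻ y in cell L, G (Function.update X i y) :=
    (measurable_lintegral_update i hG).const_mul _
  rw [lintegral_cellN_slot L i hF hA hFi, lintegral_cellN_slot L i hF hG hFi]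
  refine lintegral_congr fun Y => ?_
  congr 1
  simp only [Fin.update_insertNth]
  rw [setLIntegral_const, volume_cell, ← ENNReal.ofReal_pow hL.le, mul_comm _ (∫⁻ y in cell L, _),
    mul_assoc, ENNReal.inv_mul_cancel hL3 ENNReal.ofReal_ne_top, mul_one]

/-- Special case `F = 1`: `∫_{cell^N} L⁻³ ∫⁻_cell G(X; x_i ↦ y) dy dX = ∫_{cell^N} G`. [folklore] -/
theorem lintegral_cellN_slotAvg (hL : 0 < L) (i : Fin (n + 1)) {G : Config (n + 1) → ℝ≥0∞}
    (hG : Measurable G) :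
    ∫⁻ X in cellN (n + 1) L, (ENNReal.ofReal (L ^ 3))⁻¹ * ∫⁻ y in cell L, G (Function.update X i y) =
      ∫⁻ X in cellN (n + 1) L, G X := by
  have h := lintegral_cellN_mul_slotAvg hL i (F := fun _ => 1) measurable_const hG (fun _ _ => rfl)
  simpa only [one_mul] using h

/-! ## Jensen on the cell -/

/-- **Jensen / Cauchy–Schwarz on the cell**: `|L⁻³ ∫_cell f|² ≤ L⁻³ ∫_cell |f|²`. [folklore] -/
theorem nnnorm_sq_smul_setIntegral_le (hL : 0 < L) {f : Space → ℂ}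
    (hf : AEStronglyMeasurable f ((volume : Measure Space).restrict (cell L))) :
    ((‖((L ^ 3)⁻¹ : ℝ) • ∫ y in cell L, f y‖₊ : ℝ≥0∞)) ^ 2 ≤
      (ENNReal.ofReal (L ^ 3))⁻¹ * ∫⁻ y in cell L, ((‖f y‖₊ : ℝ≥0∞)) ^ 2 := by
  have hL3 : 0 < L ^ 3 := by positivity
  have hL3' : ENNReal.ofReal (L ^ 3) ≠ 0 := (ENNReal.ofReal_pos.2 hL3).ne'
  set A : ℝ≥0∞ := ∫⁻ y in cell L, ((‖f y‖₊ : ℝ≥0∞)) ^ 2 with hA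
  -- Cauchy–Schwarz `(∫|f|)² ≤ (∫|f|²)·L³`
  have hsq : ∀ a : ℝ≥0∞, (a ^ (1 / 2 : ℝ)) ^ 2 = a := fun a => by
    rw [← ENNReal.rpow_two, ← ENNReal.rpow_mul]; norm_num
  have hCS : (∫⁻ y in cell L, (‖f y‖₊ : ℝ≥0∞)) ^ 2 ≤ A * ENNReal.ofReal (L ^ 3) := by
    have h := ENNReal.lintegral_mul_le_Lp_mul_Lq ((volume : Measure Space).restrict (cell L))
      Real.HolderConjugate.two_two hf.enorm (aemeasurable_const (b := (1 : ℝ≥0∞)))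
    simp only [Pi.mul_apply, mul_one, one_pow, ENNReal.rpow_two, enorm_eq_nnnorm] at h
    calc (∫⁻ y in cell L, (‖f y‖₊ : ℝ≥0∞)) ^ 2
        ≤ ((∫⁻ y in cell L, (‖f y‖₊ : ℝ≥0∞) ^ 2) ^ (1 / 2 : ℝ) *
            (∫⁻ _ in cell L, (1 : ℝ≥0∞)) ^ (1 / 2 : ℝ)) ^ 2 := by
          gcongr
      _ = A * ENNReal.ofReal (L ^ 3) := by
          rw [mul_pow, hsq, hsq, setLIntegral_const, one_mul, volume_cell, ENNReal.ofReal_pow hL.le]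
  -- the prefactor
  have hc : ((‖((L ^ 3)⁻¹ : ℝ)‖₊ : ℝ≥0∞)) = (ENNReal.ofReal (L ^ 3))⁻¹ := by
    rw [← ENNReal.ofReal_inv_of_pos hL3, ← enorm_eq_nnnorm, ← ofReal_norm,
      Real.norm_of_nonneg (inv_nonneg.2 hL3.le)]
  calc ((‖((L ^ 3)⁻¹ : ℝ) • ∫ y in cell L, f y‖₊ : ℝ≥0∞)) ^ 2
      = (ENNReal.ofReal (L ^ 3))⁻¹ ^ 2 * ((‖∫ y in cell L, f y‖₊ : ℝ≥0∞)) ^ 2 := by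
        rw [nnnorm_smul, ENNReal.coe_mul, mul_pow, hc]
    _ ≤ (ENNReal.ofReal (L ^ 3))⁻¹ ^ 2 * (∫⁻ y in cell L, (‖f y‖₊ : ℝ≥0∞)) ^ 2 := by
        gcongr
        have h := enorm_integral_le_lintegral_enorm (μ := (volume : Measure Space).restrict (cell L)) f
        simpa only [enorm_eq_nnnorm] using h
    _ ≤ (ENNReal.ofReal (L ^ 3))⁻¹ ^ 2 * (A * ENNReal.ofReal (L ^ 3)) := by gcongr
    _ = (ENNReal.ofReal (L ^ 3))⁻¹ * A *
          ((ENNReal.ofReal (L ^ 3))⁻¹ * ENNReal.ofReal (L ^ 3)) := by ring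
    _ = (ENNReal.ofReal (L ^ 3))⁻¹ * A := by
        rw [ENNReal.inv_mul_cancel hL3' ENNReal.ofReal_ne_top, mul_one]

/-- **Jensen for the cell average**: `|P_i h(X)|² ≤ L⁻³ ∫_cell |h(X; x_i ↦ y)|² dy`. [folklore] -/
theorem nnnorm_sq_cellAvg_le (hL : 0 < L) (i : Fin N) {h : Config N → ℂ} (hh : Measurable h)
    (X : Config N) :
    ((‖cellAvg N L i h X‖₊ : ℝ≥0∞)) ^ 2 ≤
      (ENNReal.ofReal (L ^ 3))⁻¹ *
        ∫⁻ y in cell L, ((‖h (Function.update X i y)‖₊ : ℝ≥0∞)) ^ 2 := by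
  unfold cellAvg
  exact nnnorm_sq_smul_setIntegral_le hL (hh.comp (measurable_update X)).aestronglyMeasurable

/-! ## Mass of the cell average -/

/-- `X ↦ |h X|²` is measurable for measurable `h`. [folklore] -/
theorem measurable_nnnorm_sq {h : Config N → ℂ} (hh : Measurable h) :
    Measurable fun X => ((‖h X‖₊ : ℝ≥0∞)) ^ 2 :=
  (hh.nnnorm.coe_nnreal_ennreal).pow_const 2

/-- **`‖P_i h‖² ≤ ‖h‖²`** on `cell^N` for continuous `h` (`L > 0`). [folklore] -/
theorem mass_cellAvg_le (hL : 0 < L) (i : Fin (n + 1)) {h : Config (n + 1) → ℂ}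
    (hh : Continuous h) : mass L (cellAvg (n + 1) L i h) ≤ mass L h := by
  unfold mass
  calc ∫⁻ X in cellN (n + 1) L, ((‖cellAvg (n + 1) L i h X‖₊ : ℝ≥0∞)) ^ 2
      ≤ ∫⁻ X in cellN (n + 1) L, (ENNReal.ofReal (L ^ 3))⁻¹ *
          ∫⁻ y in cell L, ((‖h (Function.update X i y)‖₊ : ℝ≥0∞)) ^ 2 :=
        lintegral_mono fun X => nnnorm_sq_cellAvg_le hL i hh.measurable X
    _ = ∫⁻ X in cellN (n + 1) L, ((‖h X‖₊ : ℝ≥0∞)) ^ 2 :=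
        lintegral_cellN_slotAvg hL i (measurable_nnnorm_sq hh.measurable)

/-! ## Interaction of the cell average -/

/-- The pair weight `X ↦ v^per(x_a - x_b)` is measurable. [folklore] -/
theorem measurable_pairPot {v : ℝ → ℝ≥0∞} (hv : Measurable v) (L : ℝ) (a b : Fin N) :
    Measurable fun X : Config N => periodizedPotential v L (X a - X b) := by
  have hab : Measurable fun X : Config N => X a - X b :=
    (measurable_pi_apply a).sub (measurable_pi_apply b)
  unfold periodizedPotential
  exact Measurable.tsum fun k => hv.comp ((hab.sub_const _).norm)

/-- **Unfolding the periodisation in slot `i`**: for `i ∈ {a, b}`, `a ≠ b`,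
`L⁻³ ∫⁻_cell v^per((X; x_i ↦ y)_a - (X; x_i ↦ y)_b) dy = L⁻³ ‖v‖₁`. [folklore] -/
theorem slotAvg_pairPot (hL : 0 < L) {v : ℝ → ℝ≥0∞} (hv : Measurable v) {i a b : Fin N}
    (hab : a ≠ b) (hi : i = a ∨ i = b) (X : Config N) :
    ∫⁻ y in cell L, periodizedPotential v L (Function.update X i y a - Function.update X i y b) =
      ∫⁻ x : Space, v ‖x‖ := by
  rcases hi with rfl | rfl
  · simp only [Function.update_self, Function.update_of_ne hab.symm]
    exact lintegral_cell_periodizedPotential_sub hL hv (X b)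
  · simp only [Function.update_self, Function.update_of_ne hab]
    -- `v^per(-z) = v^per(z)`: re-index the lattice sum (as in `PeriodicBoseGasTagged`)
    have hneg : ∀ z : Space, periodizedPotential v L (-z) = periodizedPotential v L z := by
      intro z
      unfold periodizedPotential
      calc ∑' k : Fin 3 → ℤ, v ‖-z - latticeVec L k‖
          = ∑' k : Fin 3 → ℤ, (fun q => v ‖z - latticeVec L q‖) (Equiv.neg (Fin 3 → ℤ) k) :=
            tsum_congr fun k => by
              simp only [Equiv.neg_apply, latticeVec_neg, sub_neg_eq_add]
              rw [← norm_neg (z + latticeVec L k), neg_add']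
        _ = ∑' q : Fin 3 → ℤ, v ‖z - latticeVec L q‖ :=
            (Equiv.neg (Fin 3 → ℤ)).tsum_eq fun q => v ‖z - latticeVec L q‖
    have h : ∀ y : Space, periodizedPotential v L (X a - y) = periodizedPotential v L (y - X a) :=
      fun y => by rw [← hneg, neg_sub]
    simp only [h]
    exact lintegral_cell_periodizedPotential_sub hL hv (X a)

/-- **One pair against `|P_i h|²`**: `∫ W_{ab}|P_i h|² ≤ ∫ W_{ab}|h|² + L⁻³‖v‖₁‖h‖²`
(`i ∉ {a,b}`: Jensen and Fubini in slot `i`; `i ∈ {a,b}`: `|P_i h|²` is flat in slot `i` and the slot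
integral of `W_{ab}` is `‖v‖₁`). [folklore] -/
theorem lintegral_pairPot_sq_cellAvg_le (hL : 0 < L) {v : ℝ → ℝ≥0∞} (hv : Measurable v)
    (i : Fin (n + 1)) {a b : Fin (n + 1)} (hab : a ≠ b) {h : Config (n + 1) → ℂ}
    (hh : Continuous h) :
    ∫⁻ X in cellN (n + 1) L, periodizedPotential v L (X a - X b) *
        ((‖cellAvg (n + 1) L i h X‖₊ : ℝ≥0∞)) ^ 2 ≤
      (∫⁻ X in cellN (n + 1) L, periodizedPotential v L (X a - X b) * ((‖h X‖₊ : ℝ≥0∞)) ^ 2) +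
        (ENNReal.ofReal (L ^ 3))⁻¹ * (∫⁻ x : Space, v ‖x‖) * mass L h := by
  have hW := measurable_pairPot hv L a b (N := n + 1)
  have hPc : Continuous (cellAvg (n + 1) L i h) := continuous_cellAvg i hh
  by_cases hi : i = a ∨ i = b
  · -- `|P_i h|²` is flat in slot `i`
    refine le_add_left ?_
    have hflat : ∀ (X : Config (n + 1)) (y : Space),
        ((‖cellAvg (n + 1) L i h (Function.update X i y)‖₊ : ℝ≥0∞)) ^ 2 =
          ((‖cellAvg (n + 1) L i h X‖₊ : ℝ≥0∞)) ^ 2 := fun X y => by rw [cellAvg_update]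
    calc ∫⁻ X in cellN (n + 1) L, periodizedPotential v L (X a - X b) *
          ((‖cellAvg (n + 1) L i h X‖₊ : ℝ≥0∞)) ^ 2
        = ∫⁻ X in cellN (n + 1) L, ((‖cellAvg (n + 1) L i h X‖₊ : ℝ≥0∞)) ^ 2 *
            periodizedPotential v L (X a - X b) := lintegral_congr fun X => mul_comm _ _
      _ = ∫⁻ X in cellN (n + 1) L, ((‖cellAvg (n + 1) L i h X‖₊ : ℝ≥0∞)) ^ 2 *
            ((ENNReal.ofReal (L ^ 3))⁻¹ * ∫⁻ y in cell L,
              periodizedPotential v L (Function.update X i y a - Function.update X i y b)) :=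
          (lintegral_cellN_mul_slotAvg hL i (measurable_nnnorm_sq hPc.measurable) hW hflat).symm
      _ = ∫⁻ X in cellN (n + 1) L, ((‖cellAvg (n + 1) L i h X‖₊ : ℝ≥0∞)) ^ 2 *
            ((ENNReal.ofReal (L ^ 3))⁻¹ * ∫⁻ x : Space, v ‖x‖) :=
          lintegral_congr fun X => by rw [slotAvg_pairPot hL hv hab hi X]
      _ = (ENNReal.ofReal (L ^ 3))⁻¹ * (∫⁻ x : Space, v ‖x‖) * mass L (cellAvg (n + 1) L i h) := by
          rw [lintegral_mul_const _ (measurable_nnnorm_sq hPc.measurable), mul_comm]; rfl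
      _ ≤ (ENNReal.ofReal (L ^ 3))⁻¹ * (∫⁻ x : Space, v ‖x‖) * mass L h := by
          gcongr; exact mass_cellAvg_le hL i hh
  · -- `W_{ab}` is flat in slot `i`: Jensen and Fubini
    refine le_add_right ?_
    obtain ⟨hia, hib⟩ := not_or.1 hi
    have hflat : ∀ (X : Config (n + 1)) (y : Space),
        periodizedPotential v L (Function.update X i y a - Function.update X i y b) =
          periodizedPotential v L (X a - X b) := fun X y => by
      rw [Function.update_of_ne (Ne.symm hia), Function.update_of_ne (Ne.symm hib)]
    calc ∫⁻ X in cellN (n + 1) L, periodizedPotential v L (X a - X b) *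
          ((‖cellAvg (n + 1) L i h X‖₊ : ℝ≥0∞)) ^ 2
        ≤ ∫⁻ X in cellN (n + 1) L, periodizedPotential v L (X a - X b) *
            ((ENNReal.ofReal (L ^ 3))⁻¹ *
              ∫⁻ y in cell L, ((‖h (Function.update X i y)‖₊ : ℝ≥0∞)) ^ 2) :=
          lintegral_mono fun X => mul_le_mul' le_rfl (nnnorm_sq_cellAvg_le hL i hh.measurable X)
      _ = ∫⁻ X in cellN (n + 1) L, periodizedPotential v L (X a - X b) * ((‖h X‖₊ : ℝ≥0∞)) ^ 2 :=
          lintegral_cellN_mul_slotAvg hL i hW (measurable_nnnorm_sq hh.measurable) hflat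

/-- The interaction integral as a sum over pairs. [folklore] -/
theorem lintegral_interaction_mul_eq_sum {v : ℝ → ℝ≥0∞} (hv : Measurable v) (L : ℝ)
    {q : Config N → ℝ≥0∞} (hq : Measurable q) :
    ∫⁻ X in cellN N L, periodicInteraction v L X * q X =
      ∑ a : Fin N, ∑ b ∈ (Finset.univ : Finset (Fin N)).filter (fun b => a < b),
        ∫⁻ X in cellN N L, periodizedPotential v L (X a - X b) * q X := by
  have hmeas : ∀ a b : Fin N, Measurable fun X : Config N =>
      periodizedPotential v L (X a - X b) * q X := fun a b => (measurable_pairPot hv L a b).mul hq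
  unfold periodicInteraction
  simp only [Finset.sum_mul]
  rw [lintegral_finsetSum _ fun a _ => Finset.measurable_sum _ fun b _ => hmeas a b]
  exact Finset.sum_congr rfl fun a _ => lintegral_finsetSum _ fun b _ => hmeas a b

/-- **Interaction of the cell average**: `∫ V|P_i h|² ≤ ∫ V|h|² + N²·L⁻³‖v‖₁·‖h‖²`
(`V = Σ_{a<b} v^per(x_a - x_b)`). [folklore] -/
theorem lintegral_interaction_sq_cellAvg_le (hL : 0 < L) {v : ℝ → ℝ≥0∞} (hv : Measurable v)
    (i : Fin (n + 1)) {h : Config (n + 1) → ℂ} (hh : Continuous h) :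
    ∫⁻ X in cellN (n + 1) L, periodicInteraction v L X *
        ((‖cellAvg (n + 1) L i h X‖₊ : ℝ≥0∞)) ^ 2 ≤
      (∫⁻ X in cellN (n + 1) L, periodicInteraction v L X * ((‖h X‖₊ : ℝ≥0∞)) ^ 2) +
        ((n + 1 : ℕ) : ℝ≥0∞) ^ 2 *
          ((ENNReal.ofReal (L ^ 3))⁻¹ * (∫⁻ x : Space, v ‖x‖) * mass L h) := by
  set K : ℝ≥0∞ := (ENNReal.ofReal (L ^ 3))⁻¹ * (∫⁻ x : Space, v ‖x‖) * mass L h with hK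
  have hPc : Continuous (cellAvg (n + 1) L i h) := continuous_cellAvg i hh
  rw [lintegral_interaction_mul_eq_sum hv L (measurable_nnnorm_sq hPc.measurable),
    lintegral_interaction_mul_eq_sum hv L (measurable_nnnorm_sq hh.measurable)]
  calc ∑ a : Fin (n + 1), ∑ b ∈ (Finset.univ : Finset (Fin (n + 1))).filter (fun b => a < b),
        ∫⁻ X in cellN (n + 1) L, periodizedPotential v L (X a - X b) *
          ((‖cellAvg (n + 1) L i h X‖₊ : ℝ≥0∞)) ^ 2
      ≤ ∑ a : Fin (n + 1), ∑ b ∈ (Finset.univ : Finset (Fin (n + 1))).filter (fun b => a < b),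
          ((∫⁻ X in cellN (n + 1) L, periodizedPotential v L (X a - X b) * ((‖h X‖₊ : ℝ≥0∞)) ^ 2) +
            K) := by
        refine Finset.sum_le_sum fun a _ => Finset.sum_le_sum fun b hb => ?_
        exact lintegral_pairPot_sq_cellAvg_le hL hv i (ne_of_lt (Finset.mem_filter.1 hb).2) hh
    _ = (∑ a : Fin (n + 1), ∑ b ∈ (Finset.univ : Finset (Fin (n + 1))).filter (fun b => a < b),
          ∫⁻ X in cellN (n + 1) L, periodizedPotential v L (X a - X b) * ((‖h X‖₊ : ℝ≥0∞)) ^ 2) +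
          ∑ a : Fin (n + 1), ∑ _b ∈ (Finset.univ : Finset (Fin (n + 1))).filter (fun b => a < b),
            K := by
        rw [← Finset.sum_add_distrib]
        exact Finset.sum_congr rfl fun a _ => Finset.sum_add_distrib
    _ ≤ _ := by
        gcongr
        calc ∑ a : Fin (n + 1), ∑ _b ∈ (Finset.univ : Finset (Fin (n + 1))).filter (fun b => a < b), K
            ≤ ∑ _a : Fin (n + 1), ∑ _b : Fin (n + 1), K :=
              Finset.sum_le_sum fun a _ =>
                Finset.sum_le_sum_of_subset (Finset.filter_subset _ _)
          _ = ((n + 1 : ℕ) : ℝ≥0∞) ^ 2 * K := by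
              simp only [Finset.sum_const, Finset.card_univ, Fintype.card_fin, nsmul_eq_mul]
              ring

end Bare

/-- **Part 1 of `stub_bareAdmissible` (registered helper statement)**: the crux's cell average `P_i` does not
increase the mass on the cell, `‖P_i h‖² ≤ ‖h‖²` for continuous `h` and `L > 0` (Jensen on the cell and Fubini
in slot `i`). [folklore] -/
theorem bareAdmissible_mass_cellAvg_le :
    ∀ (n : ℕ) (L : ℝ), 0 < L → ∀ (i : Fin (n + 1))
      (h : Literature.MathematicalPhysics.QuantumManyBody.BoseGas.Config (n + 1) → ℂ), Continuous h →
        mass L (Summit.AtomisticToContinuum.BoseEinsteinCondensation.Theorems.GaussianDominationCan.Negative.cellAvg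
          (n + 1) L i h) ≤ mass L h :=
  fun _ _ hL i _ hh => Bare.mass_cellAvg_le hL i hh

end Summit.AtomisticToContinuum.BoseEinsteinCondensation.Cruxes.GDTransfer.DysonDressedWitness

end
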